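import Literature.Analysis.OperatorTheory.Enflo2023.Lemma1Setup
import Literature.Analysis.OperatorTheory.Enflo2023.Lemma1Arith
import Literature.Analysis.OperatorTheory.Enflo2023.Extras
import Literature.Analysis.OperatorTheory.Enflo2023.PartAHandoff
import HarnessLib

/-!
# Enflo (2023), Lemma 1 over the actual minimisers, and Part A from the manuscript's own start

Source: P. H. Enflo, *On the invariant subspace problem in Hilbert spaces*, arXiv:2305.15442v2,
pp. 7–9 (tex L263–L320: the choice of `u₀ ⟂ u₁`, `y₀' = (√3/2)u₀`, `x₀ = (√3/2)u₀ + ½u₁`, and LEMMA 1)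
— a CLAIMED result under adjudication; this file reproduces and ADJUDICATES the inference, it does not
endorse the manuscript's main theorem.  BLOCK-2b value: certificate / precise gap, not summit progress.

What is here (kernel-checked, no `sorry`), with `V_y a = Σ a_j T^j y` (`Vy.V`), `IsMinimal` = problem (1):

* `step_radius` — the sharp form of the scaling step (10): if `εθ(ℓ'_ε) ≥ θ`, `0 ≤ δ ≤ θ`, `ε ≤ ½` then
  `(1+δ)ℓ'_ε` is feasible at radius `ε − δθ`; hence `‖ℓ'_{ε−δθ}‖ ≤ (1+δ)‖ℓ'_ε‖`.
* `u1_coord_lower_bound` — the `u₁`-coordinate of `x₀ − V_{y₀'} a` is `½ − ⟨T*u₁, V(La)⟩`, so feasibility at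
  radius `½ − w` forces `w ≤ 0.872·‖T*u₁‖·‖a‖` (for `‖T‖ ≤ 1/10`).
* `lemma1_repaired` — **LEMMA 1, repaired and parametric**: if `‖T*u₁‖ ≤ t/4` (`0 < t ≤ 1/100`) then for some
  `ε ∈ [½ − 2t, ½]` the minimiser `ℓ'_ε` EXISTS and has `εθ(ℓ'_ε) ≤ t`.  Growth along the grid is `e²`
  (not the `e^{20}` of a `δεθ/10`-step reading), so with the printed target `t = ½·10⁻⁵(εθ)₀`:
  `lemma1_printed_of_ge` — the printed hypothesis-free choice of `u₁` (any unit `u₁ ⟂ u₀`, using only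
  `‖T*u₁‖ ≤ ‖T‖ ≤ 10⁻²⁰`) suffices whenever `(εθ)₀ ≥ 8·10⁻¹⁵`; `lemma1_printed_of_adjoint_le` — in general the
  p.7 requirement "‖T*u₁‖ < (εθ)₀" must be sharpened to `‖T*u₁‖ ≤ 1.25·10⁻⁶(εθ)₀` (that the printed requirement alone is NOT enough is
  shown on the rank-one model `T = λ⟨·,u₀⟩u₁` in the cell's audit packet; companion module `Lemma1Model`).
* `exists_unit_orthogonal_adjoint_le` — the sharpened choice EXISTS under the standing hypotheses of p.1
  (`R(T)` dense — WLOG by `Reductions.hasNontrivialClosedInvariantSubspace_of_range_not_dense` — and `R(T) ≠ H`):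
  for every `η > 0` there is a unit `u₁ ⟂ u₀` with `‖T*u₁‖ ≤ η`.  Dense range is load-bearing (for the forward
  shift and `u₀ = e₀` no such `u₁` exists).
* `partA_entry_data`, `partA_from_start`, `partA_from_standing` — the minimiser `y₁' = V ℓ'_ε` delivers EVERY
  hypothesis of `CaseII.partA_handoff` (‖x₀‖ = 1, window, `εθ` real in `[0, 10⁻⁴]`, (9) for all `m`, the cone
  condition `Re⟨u₀, y₁'⟩ ≥ ‖y₁'‖/100`), so Part A ((26)–(33)) now starts from the manuscript's p.1/p.7 data.

Typo fixed, not adjudicated: p.7 prints `x₀ = (√3/2)u₀ + u₁` (norm `√7/2`); `‖x₀‖ = 1` and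
`‖x₀ − y₀'‖ = ½` force `x₀ = (√3/2)u₀ + ½u₁`, used here (`xStart`).
Origin: planner-b2b-enflo-1-g9-0 (formaliser 1, gen 9), 2026-08-19.
-/

noncomputable section

open scoped InnerProductSpace ENNReal
open ContinuousLinearMap
open Literature.Analysis.UnboundedOperators (inner_self_eq_coe_norm_sq)

namespace Literature.Analysis.OperatorTheory.Enflo2023

namespace Lemma1

open Vy

variable {H : Type*} [NormedAddCommGroup H] [InnerProductSpace ℂ H] [CompleteSpace H]

/-! ### The frame of v2 p.7: `y₀' = (√3/2)u₀`, `x₀ = (√3/2)u₀ + ½u₁` -/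

/-- `x₀ = (√3/2)u₀ + ½u₁` (v2 p.7, with the evident typo `+u₁ ↦ +½u₁` fixed so that `‖x₀‖ = 1`). [cite: Enflo2023, v2 p.7, choice of x₀] -/
def xStart (u₀ u₁ : H) : H := ((Real.sqrt 3 / 2 : ℝ) : ℂ) • u₀ + ((1 / 2 : ℝ) : ℂ) • u₁

/-- `y₀' = (√3/2)u₀` (v2 p.7). [cite: Enflo2023, v2 p.7, choice of y₀'] -/
def yStart (u₀ : H) : H := ((Real.sqrt 3 / 2 : ℝ) : ℂ) • u₀

omit [CompleteSpace H] in
/-- `x₀ − y₀' = ½u₁`. [cite: Enflo2023, v2 p.7] -/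
lemma xStart_sub_yStart (u₀ u₁ : H) : xStart u₀ u₁ - yStart u₀ = ((1 / 2 : ℝ) : ℂ) • u₁ := by
  simp [xStart, yStart]

omit [CompleteSpace H] in
/-- `‖x₀‖ = 1`. [cite: Enflo2023, v2 p.7] -/
lemma norm_xStart (u₀ u₁ : H) (hu₀ : ‖u₀‖ = 1) (hu₁ : ‖u₁‖ = 1) (h01 : ⟪u₀, u₁⟫_ℂ = 0) :
    ‖xStart u₀ u₁‖ = 1 := by
  have h := norm_sq_two_frame u₀ u₁ hu₀ hu₁ h01 ((Real.sqrt 3 / 2 : ℝ) : ℂ) ((1 / 2 : ℝ) : ℂ)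
  have hsq : (Real.sqrt 3 / 2) ^ 2 = 3 / 4 := by
    rw [div_pow, Real.sq_sqrt (by norm_num)]; norm_num
  rw [Complex.norm_real, Complex.norm_real, Real.norm_of_nonneg (by positivity),
    Real.norm_of_nonneg (by norm_num), hsq] at h
  have h1 : ‖xStart u₀ u₁‖ ^ 2 = 1 := by rw [xStart, h]; norm_num
  exact (pow_eq_one_iff_of_nonneg (norm_nonneg _) (by norm_num)).1 h1

omit [CompleteSpace H] in
/-- `‖y₀'‖ = √3/2`. [cite: Enflo2023, v2 p.7] -/
lemma norm_yStart (u₀ : H) (hu₀ : ‖u₀‖ = 1) : ‖yStart u₀‖ = Real.sqrt 3 / 2 := by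
  rw [yStart, norm_smul, Complex.norm_real, Real.norm_of_nonneg (by positivity), hu₀, mul_one]

omit [CompleteSpace H] in
/-- `‖x₀ − y₀'‖ = ½`: `y₀'` itself is feasible at radius `½`, so `‖ℓ'_{1/2}‖ ≤ 1` (v2 p.8 l.−1). [cite: Enflo2023, v2 p.8, Lemma 1 set-up] -/
lemma norm_xStart_sub_yStart (u₀ u₁ : H) (hu₁ : ‖u₁‖ = 1) : ‖xStart u₀ u₁ - yStart u₀‖ = 1 / 2 := by
  rw [xStart_sub_yStart, norm_smul, Complex.norm_real, Real.norm_of_nonneg (by norm_num), hu₁, mul_one]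

omit [CompleteSpace H] in
/-- The `u₁`-coordinate of `x₀` is `½`. [cite: Enflo2023, v2 p.7] -/
lemma inner_u₁_xStart (u₀ u₁ : H) (hu₁ : ‖u₁‖ = 1) (h01 : ⟪u₀, u₁⟫_ℂ = 0) :
    ⟪u₁, xStart u₀ u₁⟫_ℂ = 1 / 2 := by
  have h10 : ⟪u₁, u₀⟫_ℂ = 0 := by rw [← inner_conj_symm, h01, map_zero]
  have h11 : ⟪u₁, u₁⟫_ℂ = 1 := by rw [inner_self_eq_norm_sq_to_K, hu₁]; norm_num
  rw [xStart, inner_add_right, inner_smul_right, inner_smul_right, h10, h11, mul_zero, zero_add, mul_one]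
  push_cast; ring

omit [CompleteSpace H] in
/-- The `u₀`-coordinate of `x₀` is `√3/2`. [cite: Enflo2023, v2 p.7] -/
lemma re_inner_u₀_xStart (u₀ u₁ : H) (hu₀ : ‖u₀‖ = 1) (h01 : ⟪u₀, u₁⟫_ℂ = 0) :
    (⟪u₀, xStart u₀ u₁⟫_ℂ).re = Real.sqrt 3 / 2 := by
  have h00 : ⟪u₀, u₀⟫_ℂ = 1 := by rw [inner_self_eq_norm_sq_to_K, hu₀]; norm_num
  rw [xStart, inner_add_right, inner_smul_right, inner_smul_right, h00, h01, mul_zero, add_zero, mul_one,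
    Complex.ofReal_re]

/-! ### (10), sharp: one scaling step lowers the radius by `δ·θ` -/

omit [CompleteSpace H] in
/-- **The scaling step (10), sharp form.**  If `‖v‖ ≤ 1`, `‖x₀ − v‖ ≤ ε ≤ ½`, `Re⟨x₀ − v, v⟩ ≥ θ` and
`0 ≤ δ ≤ θ` (with `δθ ≤ ε`), then `‖x₀ − (1+δ)v‖ ≤ ε − δθ`.  (From `‖x₀ − (1+δ)v‖² = ‖x₀ − v‖² − 2δ·Re⟨x₀−v,v⟩
+ δ²‖v‖²`; the text's step lowers the radius by `δεθ/10` only, which is what produced the `e^{20}` growth of the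
arithmetic audit `Lemma1Arith`; the sharp step gives growth `e²` below.) [cite: Enflo2023, v2 p.4 eq. (10), p.9 l.1–6] -/
theorem step_radius (x₀ v : H) {ε θ δ : ℝ} (hv : ‖v‖ ≤ 1) (hfe : ‖x₀ - v‖ ≤ ε)
    (hθ : θ ≤ (⟪x₀ - v, v⟫_ℂ).re) (hδ0 : 0 ≤ δ) (hδθ : δ ≤ θ) (hε : ε ≤ 1 / 2) (hδε : δ * θ ≤ ε) :
    ‖x₀ - ((1 + δ : ℝ) : ℂ) • v‖ ≤ ε - δ * θ := by
  have hid := norm_sub_add_smul_sq x₀ v δ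
  have h0 : 0 ≤ ‖x₀ - v‖ := norm_nonneg _
  have h1 : ‖x₀ - v‖ ^ 2 ≤ ε ^ 2 := pow_le_pow_left₀ h0 hfe 2
  have h2 : δ ^ 2 * ‖v‖ ^ 2 ≤ δ ^ 2 := by
    have : ‖v‖ ^ 2 ≤ 1 := by nlinarith [norm_nonneg v]
    nlinarith [sq_nonneg δ]
  have hθ0 : 0 ≤ θ := hδ0.trans hδθ
  have h3 : ‖x₀ - ((1 + δ : ℝ) : ℂ) • v‖ ^ 2 ≤ (ε - δ * θ) ^ 2 := by
    rw [hid]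
    nlinarith [mul_nonneg hδ0 hθ0, mul_nonneg hδ0 (sub_nonneg.2 hδθ), mul_nonneg (mul_nonneg hδ0 hθ0) (sub_nonneg.2 hε)]
  have h4 : 0 ≤ ε - δ * θ := by linarith
  exact (pow_le_pow_iff_left₀ (norm_nonneg _) h4 (by norm_num : (2:ℕ) ≠ 0)).1 h3

/-! ### The `u₁`-coordinate: feasibility near radius `½` forces a large coefficient vector -/

/-- `⟨u₁, V_{y₀'} a⟩ = ⟨T*u₁, V_{y₀'}(La)⟩`: the head `a₀y₀' ∈ ℂu₀` is invisible to `u₁`, and the tail is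
`T(V(La))` (`Vy.V_decomp`). [cite: Enflo2023, v2 p.9, l.7–12] -/
theorem inner_u₁_V (T : H →L[ℂ] H) (hT : ‖T‖ < 1) (u₀ u₁ : H) (h01 : ⟪u₀, u₁⟫_ℂ = 0) (a : ℓ2) :
    ⟪u₁, V T hT (yStart u₀) a⟫_ℂ = ⟪adjoint T u₁, V T hT (yStart u₀) (L a)⟫_ℂ := by
  have h10 : ⟪u₁, u₀⟫_ℂ = 0 := by rw [← inner_conj_symm, h01, map_zero]
  rw [V_decomp T hT (yStart u₀) a, inner_add_right, inner_smul_right, yStart, inner_smul_right, h10,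
    mul_zero, mul_zero, zero_add, adjoint_inner_left]

omit [CompleteSpace H] in
/-- `‖V_{y₀'}‖ ≤ (√3/2)(1 − ‖T‖²)^{-1/2} ≤ 0.872` for `‖T‖ ≤ 1/10`. [folklore] -/
lemma opNorm_factor_le (T : H →L[ℂ] H) (hT10 : ‖T‖ ≤ 1 / 10) :
    Real.sqrt 3 / 2 * Real.sqrt (1 / (1 - ‖T‖ ^ 2)) ≤ 0.872 := by
  have hs : Real.sqrt (1 / (1 - ‖T‖ ^ 2)) ≤ 1.006 := by
    have hpos : 0 < 1 - ‖T‖ ^ 2 := by nlinarith [norm_nonneg T]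
    have h1 : 1 / (1 - ‖T‖ ^ 2) ≤ 1.006 ^ 2 := by
      rw [div_le_iff₀ hpos]; nlinarith [norm_nonneg T]
    calc Real.sqrt (1 / (1 - ‖T‖ ^ 2)) ≤ Real.sqrt (1.006 ^ 2) := Real.sqrt_le_sqrt h1
      _ = 1.006 := Real.sqrt_sq (by norm_num)
  have h3 := sqrt3_half_bounds
  nlinarith [Real.sqrt_nonneg (1 / (1 - ‖T‖ ^ 2)), h3.1, h3.2]

/-- **Lower bound from the `u₁`-coordinate** (v2 p.9 l.7–12, made quantitative): if `a` is feasible at radius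
`½ − w` for `x₀ = (√3/2)u₀ + ½u₁`, `y₀' = (√3/2)u₀`, then `w ≤ 0.872·‖T*u₁‖·‖a‖₂` (for `‖T‖ ≤ 1/10`).  This is
where the size of `‖T*u₁‖` — not `‖T‖` — enters. [cite: Enflo2023, v2 p.9, l.7–12] -/
theorem u1_coord_lower_bound (T : H →L[ℂ] H) (hT : ‖T‖ < 1) (hT10 : ‖T‖ ≤ 1 / 10) (u₀ u₁ : H)
    (hu₀ : ‖u₀‖ = 1) (hu₁ : ‖u₁‖ = 1) (h01 : ⟪u₀, u₁⟫_ℂ = 0) (a : ℓ2) {w : ℝ}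
    (hfe : ‖xStart u₀ u₁ - V T hT (yStart u₀) a‖ ≤ 1 / 2 - w) :
    w ≤ 0.872 * ‖adjoint T u₁‖ * ‖a‖ := by
  set s : ℂ := ⟪u₁, V T hT (yStart u₀) a⟫_ℂ with hs
  have h1 : ⟪u₁, xStart u₀ u₁ - V T hT (yStart u₀) a⟫_ℂ = (1 / 2 : ℂ) - s := by
    rw [inner_sub_right, inner_u₁_xStart u₀ u₁ hu₁ h01]
  have h2 : ‖(1 / 2 : ℂ) - s‖ ≤ 1 / 2 - w := by
    rw [← h1]
    calc ‖⟪u₁, xStart u₀ u₁ - V T hT (yStart u₀) a⟫_ℂ‖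
        ≤ ‖u₁‖ * ‖xStart u₀ u₁ - V T hT (yStart u₀) a‖ := norm_inner_le_norm _ _
      _ ≤ 1 / 2 - w := by rw [hu₁, one_mul]; exact hfe
  have h3 : w ≤ ‖s‖ := window_forces_tail h2
  have h4 : ‖s‖ ≤ ‖adjoint T u₁‖ * ‖V T hT (yStart u₀) (L a)‖ := by
    rw [hs, inner_u₁_V T hT u₀ u₁ h01 a]; exact norm_inner_le_norm _ _
  have h5 : ‖V T hT (yStart u₀) (L a)‖ ≤ 0.872 * ‖a‖ := by
    calc ‖V T hT (yStart u₀) (L a)‖ ≤ ‖V T hT (yStart u₀)‖ * ‖L a‖ := le_opNorm _ _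
      _ ≤ (Real.sqrt 3 / 2 * Real.sqrt (1 / (1 - ‖T‖ ^ 2))) * ‖a‖ := by
          have hV := norm_V_le T hT (yStart u₀)
          rw [norm_yStart u₀ hu₀] at hV
          exact mul_le_mul hV (norm_L_apply_le a) (norm_nonneg _) (by positivity)
      _ ≤ 0.872 * ‖a‖ := mul_le_mul_of_nonneg_right (opNorm_factor_le T hT10) (norm_nonneg _)
  have h6 : ‖adjoint T u₁‖ * ‖V T hT (yStart u₀) (L a)‖ ≤ ‖adjoint T u₁‖ * (0.872 * ‖a‖) :=
    mul_le_mul_of_nonneg_left h5 (norm_nonneg _)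
  linarith

/-! ### LEMMA 1 (repaired, parametric) over the actual minimisers -/

/-- **LEMMA 1, repaired and parametric** (v2 pp.8–9).  Let `u₀ ⟂ u₁` be unit vectors, `y₀' = (√3/2)u₀`,
`x₀ = (√3/2)u₀ + ½u₁`, `‖T‖ ≤ 1/10`, and suppose `‖T*u₁‖ ≤ t/4` with `0 < t ≤ 1/100`.  Then for some radius
`ε ∈ [½ − 2t, ½]` the minimiser `ℓ'_ε` of (1) exists and `εθ(ℓ'_ε) = Re⟨x₀ − Vℓ'_ε, Vℓ'_ε⟩ ≤ t`.
Proof = the manuscript's: grid `ε_k = ½ − k·δt`, `δ = 2/⌈2/t⌉ ≤ t`; while `εθ > t` the sharp step (10) gives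
`‖ℓ'_{ε_{k+1}}‖ ≤ (1+δ)‖ℓ'_{ε_k}‖`, so `‖ℓ'_{½−2t}‖ ≤ (1+δ)^{2/δ} ≤ e² < 7.39`, against the `u₁`-coordinate bound
`‖ℓ'_{½−2t}‖ ≥ 2t/(0.872·t/4) > 9.17`.  (Printed target: `t = ½·10⁻⁵(εθ)₀`, see `lemma1_printed_of_ge`.) [cite: Enflo2023, v2 pp.8–9, Lemma 1] -/
theorem lemma1_repaired (T : H →L[ℂ] H) (hT : ‖T‖ < 1) (hT10 : ‖T‖ ≤ 1 / 10) (u₀ u₁ : H)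
    (hu₀ : ‖u₀‖ = 1) (hu₁ : ‖u₁‖ = 1) (h01 : ⟪u₀, u₁⟫_ℂ = 0) {t : ℝ} (ht0 : 0 < t) (ht1 : t ≤ 1 / 100)
    (hη : ‖adjoint T u₁‖ ≤ t / 4) :
    ∃ (ε : ℝ) (a : ℓ2), 1 / 2 - 2 * t ≤ ε ∧ ε ≤ 1 / 2 ∧
      IsMinimal (V T hT (yStart u₀)) (xStart u₀ u₁) ε a ∧
      (⟪xStart u₀ u₁ - V T hT (yStart u₀) a, V T hT (yStart u₀) a⟫_ℂ).re ≤ t := by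
  set x₀ := xStart u₀ u₁ with hx₀def
  set y := yStart u₀ with hydef
  have hx1 : ‖x₀‖ = 1 := norm_xStart u₀ u₁ hu₀ hu₁ h01
  -- the grid
  set n : ℕ := ⌈2 / t⌉₊ with hndef
  have hn2 : 2 / t ≤ (n : ℝ) := Nat.le_ceil _
  have hnpos : (0 : ℝ) < n := lt_of_lt_of_le (by positivity) hn2
  set δ : ℝ := 2 / n with hδdef
  have hδ0 : 0 < δ := by positivity
  have hδt : δ ≤ t := by
    rw [hδdef, div_le_iff₀ hnpos]
    have := (div_le_iff₀ ht0).1 hn2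
    linarith
  have hnδ : (n : ℝ) * δ = 2 := by rw [hδdef]; field_simp
  set r : ℕ → ℝ := fun k => 1 / 2 - (k : ℝ) * (δ * t) with hrdef
  have hr0 : r 0 = 1 / 2 := by simp [hrdef]
  have hrS : ∀ k, r (k + 1) = r k - δ * t := by intro k; simp only [hrdef]; push_cast; ring
  have hrn : r n = 1 / 2 - 2 * t := by
    simp only [hrdef]; rw [← mul_assoc, hnδ]
  have hrlo : ∀ k, k ≤ n → 1 / 2 - 2 * t ≤ r k := by
    intro k hk
    have hk' : (k : ℝ) ≤ n := by exact_mod_cast hk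
    have h1 : (k : ℝ) * (δ * t) ≤ (n : ℝ) * (δ * t) :=
      mul_le_mul_of_nonneg_right hk' (by positivity)
    have h2 : (n : ℝ) * (δ * t) = 2 * t := by rw [← mul_assoc, hnδ]
    show 1 / 2 - 2 * t ≤ 1 / 2 - (k : ℝ) * (δ * t)
    linarith
  have hrhi : ∀ k, r k ≤ 1 / 2 := by
    intro k; simp only [hrdef]
    have : 0 ≤ (k : ℝ) * (δ * t) := by positivity
    linarith
  by_contra hcon
  push Not at hcon
  -- induction along the grid: minimisers exist and grow at most geometrically
  have key : ∀ k, k ≤ n → ∃ a : ℓ2, IsMinimal (V T hT y) x₀ (r k) a ∧ ‖a‖ ≤ (1 + δ) ^ k := by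
    intro k
    induction k with
    | zero =>
      intro _
      have hfe : ‖x₀ - y‖ ≤ r 0 := by rw [hr0, hx₀def, hydef, norm_xStart_sub_yStart u₀ u₁ hu₁]
      have h1 : ∀ z : H, (1 : H →L[ℂ] H) z = z := fun z => rfl
      have hfeas : lp.single 2 0 (1 : ℂ) ∈ feasible (V T hT y) x₀ (r 0) := by
        show ‖x₀ - V T hT y (lp.single 2 0 (1 : ℂ))‖ ≤ r 0
        rw [V_single, pow_zero, h1]; exact hfe
      obtain ⟨a, ha⟩ := exists_isMinimal (V T hT y) x₀ (r 0) ⟨_, hfeas⟩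
      exact ⟨a, ha, by rw [pow_zero]; exact norm_minimal_le_one T hT y x₀ (r 0) a ha hfe⟩
    | succ k ih =>
      intro hk
      have hkn : k ≤ n := Nat.le_of_succ_le hk
      obtain ⟨a, ha, hna⟩ := ih hkn
      have hlt : t < (⟪x₀ - V T hT y a, V T hT y a⟫_ℂ).re := hcon (r k) a (hrlo k hkn) (hrhi k) ha
      have hane : a ≠ 0 := ha.ne_zero (by rw [hx1]; linarith [hrhi k])
      obtain ⟨C, hC0, hC⟩ := ha.kkt hane
      have hθ0 : 0 ≤ (⟪x₀ - V T hT y a, V T hT y a⟫_ℂ).re := IsMinimal.etheta_nonneg hC0 hC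
      have hV1 : ‖V T hT y a‖ ≤ 1 := norm_move_le_one x₀ _ hx1 hθ0
      have hδε : δ * t ≤ r k := by
        have h1 : δ * t ≤ t * t := mul_le_mul_of_nonneg_right hδt ht0.le
        have h2 := hrlo k hkn
        nlinarith
      have hstep : ‖x₀ - ((1 + δ : ℝ) : ℂ) • V T hT y a‖ ≤ r k - δ * t :=
        step_radius x₀ (V T hT y a) hV1 ha.norm_sub_le hlt.le hδ0.le hδt (hrhi k) hδε
      have hfe' : ((1 + δ : ℝ) : ℂ) • a ∈ feasible (V T hT y) x₀ (r (k + 1)) := by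
        show ‖x₀ - V T hT y (((1 + δ : ℝ) : ℂ) • a)‖ ≤ r (k + 1)
        rw [map_smul, hrS]; exact hstep
      obtain ⟨b, hb⟩ := exists_isMinimal (V T hT y) x₀ (r (k + 1)) ⟨_, hfe'⟩
      refine ⟨b, hb, ?_⟩
      have hδ1 : 0 ≤ 1 + δ := by linarith
      calc ‖b‖ ≤ ‖((1 + δ : ℝ) : ℂ) • a‖ := hb.norm_le hfe'
        _ = (1 + δ) * ‖a‖ := by rw [norm_smul, Complex.norm_real, Real.norm_of_nonneg hδ1]
        _ ≤ (1 + δ) * (1 + δ) ^ k := mul_le_mul_of_nonneg_left hna hδ1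
        _ = (1 + δ) ^ (k + 1) := by ring
  obtain ⟨a, ha, hna⟩ := key n le_rfl
  -- upper bound `‖ℓ'_{½−2t}‖ ≤ e² < 7.39`
  have hup : ‖a‖ ≤ 7.39 := by
    have h1 := growth_le hδ0.le n
    rw [hnδ] at h1
    have he : Real.exp 2 < 7.39 := by
      have h4 := Real.exp_one_lt_d9
      have h3 : Real.exp 2 = Real.exp 1 ^ 2 := by rw [← Real.exp_nat_mul]; norm_num
      rw [h3]; nlinarith [Real.exp_pos 1]
    linarith
  -- lower bound from the `u₁`-coordinate: `2t ≤ 0.872·(t/4)·‖a‖`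
  have hfe : ‖x₀ - V T hT y a‖ ≤ 1 / 2 - 2 * t := by have := ha.norm_sub_le; rwa [hrn] at this
  have hlow := u1_coord_lower_bound T hT hT10 u₀ u₁ hu₀ hu₁ h01 a hfe
  have h7 : 0.872 * ‖adjoint T u₁‖ * ‖a‖ ≤ 0.872 * (t / 4) * 7.39 := by
    have := mul_le_mul hη hup (norm_nonneg _) (by positivity)
    nlinarith [norm_nonneg (adjoint T u₁), norm_nonneg a]
  linarith

/-! ### The printed parameters: `t = ½·10⁻⁵·(εθ)₀` -/

/-- For ANY unit `u₁ ⟂ u₀`, `‖T*u₁‖ ≤ ‖T*‖ = ‖T‖`. [folklore] -/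
lemma norm_adjoint_apply_le_opNorm (T : H →L[ℂ] H) (u₁ : H) (hu₁ : ‖u₁‖ = 1) : ‖adjoint T u₁‖ ≤ ‖T‖ := by
  have h := (adjoint T).le_opNorm u₁
  rw [hu₁, mul_one, ContinuousLinearMap.adjoint.norm_map T] at h
  exact h

/-- **Printed Lemma 1 holds for every orthonormal pair when `(εθ)₀ ≥ 8·10⁻¹⁵`.**  With the printed target
`εθ(ℓ'_ε) < 10⁻⁵(εθ)₀` (we deliver `≤ ½·10⁻⁵(εθ)₀`) on the printed interval `[½ − 10⁻⁵(εθ)₀, ½]`, the only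
information used about `u₁` is `‖T*u₁‖ ≤ ‖T‖ ≤ 10⁻²⁰`, which is `≤ t/4 = 1.25·10⁻⁶(εθ)₀` exactly when
`(εθ)₀ ≥ 8·10⁻¹⁵`.  (Below that threshold the printed choice of `u₁` can fail — rank-one model, audit packet / `Lemma1Model`.) [cite: Enflo2023, v2 pp.8–9, Lemma 1] -/
theorem lemma1_printed_of_ge (T : H →L[ℂ] H) (hT : ‖T‖ < 1) (hT20 : ‖T‖ ≤ 1 / 10 ^ 20) (u₀ u₁ : H)
    (hu₀ : ‖u₀‖ = 1) (hu₁ : ‖u₁‖ = 1) (h01 : ⟪u₀, u₁⟫_ℂ = 0) {e₀ : ℝ} (he : 8 / 10 ^ 15 ≤ e₀)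
    (he' : e₀ ≤ 20) :
    ∃ (ε : ℝ) (a : ℓ2), 1 / 2 - e₀ / 10 ^ 5 ≤ ε ∧ ε ≤ 1 / 2 ∧
      IsMinimal (V T hT (yStart u₀)) (xStart u₀ u₁) ε a ∧
      (⟪xStart u₀ u₁ - V T hT (yStart u₀) a, V T hT (yStart u₀) a⟫_ℂ).re ≤ e₀ / (2 * 10 ^ 5) := by
  have hT10 : ‖T‖ ≤ 1 / 10 := hT20.trans (by norm_num)
  have ht0 : 0 < e₀ / (2 * 10 ^ 5) := by positivity
  have ht1 : e₀ / (2 * 10 ^ 5) ≤ 1 / 100 := by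
    rw [div_le_iff₀ (by positivity)]; linarith
  have hη : ‖adjoint T u₁‖ ≤ e₀ / (2 * 10 ^ 5) / 4 := by
    have := norm_adjoint_apply_le_opNorm T u₁ hu₁
    have h2 : (1 : ℝ) / 10 ^ 20 ≤ e₀ / (2 * 10 ^ 5) / 4 := by
      rw [div_div, le_div_iff₀ (by positivity)]
      have : (1 : ℝ) / 10 ^ 20 * (2 * 10 ^ 5 * 4) = 8 / 10 ^ 15 := by norm_num
      linarith
    linarith
  obtain ⟨ε, a, h1, h2, h3, h4⟩ := lemma1_repaired T hT hT10 u₀ u₁ hu₀ hu₁ h01 ht0 ht1 hη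
  refine ⟨ε, a, ?_, h2, h3, h4⟩
  have : 2 * (e₀ / (2 * 10 ^ 5)) = e₀ / 10 ^ 5 := by ring
  linarith

/-- **Printed Lemma 1 with the sharpened choice of `u₁`.**  If `‖T*u₁‖ ≤ 1.25·10⁻⁶·(εθ)₀` (the p.7 requirement
`‖T*u₁‖ < (εθ)₀` sharpened by the factor `8·10⁵`; any `0 < (εθ)₀ ≤ 20`), the printed conclusion holds:
some `ε ∈ [½ − 10⁻⁵(εθ)₀, ½]` has `εθ(ℓ'_ε) ≤ ½·10⁻⁵(εθ)₀ < 10⁻⁵(εθ)₀`. [cite: Enflo2023, v2 p.7 (choice of u₁), pp.8–9 Lemma 1] -/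
theorem lemma1_printed_of_adjoint_le (T : H →L[ℂ] H) (hT : ‖T‖ < 1) (hT10 : ‖T‖ ≤ 1 / 10) (u₀ u₁ : H)
    (hu₀ : ‖u₀‖ = 1) (hu₁ : ‖u₁‖ = 1) (h01 : ⟪u₀, u₁⟫_ℂ = 0) {e₀ : ℝ} (he : 0 < e₀) (he' : e₀ ≤ 20)
    (hη : ‖adjoint T u₁‖ ≤ 1.25 / 10 ^ 6 * e₀) :
    ∃ (ε : ℝ) (a : ℓ2), 1 / 2 - e₀ / 10 ^ 5 ≤ ε ∧ ε ≤ 1 / 2 ∧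
      IsMinimal (V T hT (yStart u₀)) (xStart u₀ u₁) ε a ∧
      (⟪xStart u₀ u₁ - V T hT (yStart u₀) a, V T hT (yStart u₀) a⟫_ℂ).re ≤ e₀ / (2 * 10 ^ 5) := by
  have ht0 : 0 < e₀ / (2 * 10 ^ 5) := by positivity
  have ht1 : e₀ / (2 * 10 ^ 5) ≤ 1 / 100 := by
    rw [div_le_iff₀ (by positivity)]; linarith
  have hη' : ‖adjoint T u₁‖ ≤ e₀ / (2 * 10 ^ 5) / 4 := by
    have : (1.25 : ℝ) / 10 ^ 6 * e₀ = e₀ / (2 * 10 ^ 5) / 4 := by ring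
    linarith
  obtain ⟨ε, a, h1, h2, h3, h4⟩ := lemma1_repaired T hT hT10 u₀ u₁ hu₀ hu₁ h01 ht0 ht1 hη'
  refine ⟨ε, a, ?_, h2, h3, h4⟩
  have : 2 * (e₀ / (2 * 10 ^ 5)) = e₀ / 10 ^ 5 := by ring
  linarith

/-! ### The minimiser `y₁' = V ℓ'_ε` delivers every hypothesis of Part A -/

/-- **Entry data for Part A** (v2 p.9, "With `y₁' = ℓ'_{ε₁}y₀'` and `ε₁θ₁ = (εθ)₁` we now start …"): the minimiser
produced by `lemma1_repaired` has `‖x₀‖ = 1`, active constraint `‖x₀ − y₁'‖ = ε ∈ [½ − 2t, ½]`, `εθ` real with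
`0 ≤ εθ ≤ t` ((7)–(8), `IsMinimal.kkt`), inequality (9) for every power `T^m` (`Vy.eq9_pow`), `‖y₁'‖ ≤ 1`, and the
cone condition `Re⟨u₀, y₁'⟩ ≥ √3/2 − ½ > ‖y₁'‖/100`. [cite: Enflo2023, v2 p.9 (after Lemma 1), p.4 (7)–(9)] -/
theorem partA_entry_data (T : H →L[ℂ] H) (hT : ‖T‖ < 1) (hT10 : ‖T‖ ≤ 1 / 10) (u₀ u₁ : H)
    (hu₀ : ‖u₀‖ = 1) (hu₁ : ‖u₁‖ = 1) (h01 : ⟪u₀, u₁⟫_ℂ = 0) {t : ℝ} (ht0 : 0 < t) (ht1 : t ≤ 1 / 100)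
    (hη : ‖adjoint T u₁‖ ≤ t / 4) :
    ∃ (ε : ℝ) (a : ℓ2), 1 / 2 - 2 * t ≤ ε ∧ ε ≤ 1 / 2 ∧
      IsMinimal (V T hT (yStart u₀)) (xStart u₀ u₁) ε a ∧
      ‖xStart u₀ u₁ - V T hT (yStart u₀) a‖ = ε ∧
      (⟪xStart u₀ u₁ - V T hT (yStart u₀) a, V T hT (yStart u₀) a⟫_ℂ).im = 0 ∧
      0 ≤ (⟪xStart u₀ u₁ - V T hT (yStart u₀) a, V T hT (yStart u₀) a⟫_ℂ).re ∧
      (⟪xStart u₀ u₁ - V T hT (yStart u₀) a, V T hT (yStart u₀) a⟫_ℂ).re ≤ t ∧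
      (∀ m : ℕ, ‖⟪xStart u₀ u₁ - V T hT (yStart u₀) a, (T ^ m) (V T hT (yStart u₀) a)⟫_ℂ‖ ≤
        (⟪xStart u₀ u₁ - V T hT (yStart u₀) a, V T hT (yStart u₀) a⟫_ℂ).re) ∧
      ‖V T hT (yStart u₀) a‖ ≤ 1 ∧
      ‖V T hT (yStart u₀) a‖ / 100 ≤ (⟪u₀, V T hT (yStart u₀) a⟫_ℂ).re := by
  obtain ⟨ε, a, h1, h2, ha, hθ⟩ := lemma1_repaired T hT hT10 u₀ u₁ hu₀ hu₁ h01 ht0 ht1 hη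
  have hx1 : ‖xStart u₀ u₁‖ = 1 := norm_xStart u₀ u₁ hu₀ hu₁ h01
  have hε1 : ε < ‖xStart u₀ u₁‖ := by rw [hx1]; linarith
  have hane : a ≠ 0 := ha.ne_zero hε1
  obtain ⟨C, hC0, hC⟩ := ha.kkt hane
  have hθ0 : 0 ≤ (⟪xStart u₀ u₁ - V T hT (yStart u₀) a, V T hT (yStart u₀) a⟫_ℂ).re :=
    IsMinimal.etheta_nonneg hC0 hC
  have hV1 : ‖V T hT (yStart u₀) a‖ ≤ 1 := norm_move_le_one _ _ hx1 hθ0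
  refine ⟨ε, a, h1, h2, ha, ha.norm_sub_eq hε1, IsMinimal.etheta_im_eq_zero hC, hθ0, hθ,
    fun m => eq9_pow T hT (yStart u₀) (xStart u₀ u₁) ε a ha hane m, hV1, ?_⟩
  have hre : (⟪u₀, V T hT (yStart u₀) a⟫_ℂ).re =
      Real.sqrt 3 / 2 - (⟪u₀, xStart u₀ u₁ - V T hT (yStart u₀) a⟫_ℂ).re := by
    rw [inner_sub_right, Complex.sub_re, re_inner_u₀_xStart u₀ u₁ hu₀ h01]; ring
  have hb : (⟪u₀, xStart u₀ u₁ - V T hT (yStart u₀) a⟫_ℂ).re ≤ 1 / 2 := by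
    calc (⟪u₀, xStart u₀ u₁ - V T hT (yStart u₀) a⟫_ℂ).re
        ≤ ‖⟪u₀, xStart u₀ u₁ - V T hT (yStart u₀) a⟫_ℂ‖ := Complex.re_le_norm _
      _ ≤ ‖u₀‖ * ‖xStart u₀ u₁ - V T hT (yStart u₀) a‖ := norm_inner_le_norm _ _
      _ ≤ 1 / 2 := by rw [hu₀, one_mul, ha.norm_sub_eq hε1]; exact h2
  have h3 := sqrt3_half_bounds
  rw [hre]; linarith [h3.1]

/-- **Part A from the manuscript's own start** (v2 p.7 choice of `u₀ ⟂ u₁`, `y₀'`, `x₀`; Lemma 1; then (26)–(33)):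
for `‖T‖ ≤ 10⁻²⁰`, an orthonormal pair with `‖T*u₁‖ ≤ t/4`, `0 < t ≤ 10⁻⁴`, EITHER `T` has a non-trivial closed
invariant subspace, OR the iteration (26) started at `y₁' = Vℓ'_ε` reaches a Case-I stage `y` with `εθ` real,
`0 < εθ ≤ 1.12t`, window `[0.3 − 2.2t, 0.7]`, `y ∈ Adm u₀`, (9), and the minimiser `c` at radius `‖x₀ − y‖`
satisfying the two-sided estimates (33) with Lemma 2's `γ` — i.e. `CaseII.partA_handoff` with its eight standing
hypotheses DISCHARGED by `partA_entry_data`. [cite: Enflo2023, v2 pp.7–9 (set-up, Lemma 1), pp.9–15 eq. (26)–(33)] -/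
theorem partA_from_start (T : H →L[ℂ] H) (hT : ‖T‖ < 1) (hT20 : ‖T‖ ≤ 1 / 10 ^ 20) (u₀ u₁ : H)
    (hu₀ : ‖u₀‖ = 1) (hu₁ : ‖u₁‖ = 1) (h01 : ⟪u₀, u₁⟫_ℂ = 0) {t : ℝ} (ht0 : 0 < t) (ht1 : t ≤ 1 / 10 ^ 4)
    (hη : ‖adjoint T u₁‖ ≤ t / 4) :
    HasNontrivialClosedInvariantSubspace T ∨
      ∃ (y : H) (c : ℓ2),
        0 < (⟪xStart u₀ u₁ - y, y⟫_ℂ).re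
        ∧ (⟪xStart u₀ u₁ - y, y⟫_ℂ).im = 0
        ∧ (⟪xStart u₀ u₁ - y, y⟫_ℂ).re ≤ 1.12 * t
        ∧ 0.3 - 2.2 * t ≤ ‖xStart u₀ u₁ - y‖
        ∧ ‖xStart u₀ u₁ - y‖ ≤ 0.7
        ∧ y ∈ Lemma2.Adm u₀
        ∧ (∀ m : ℕ, ‖⟪xStart u₀ u₁ - y, (T ^ m) y⟫_ℂ‖ ≤ (⟪xStart u₀ u₁ - y, y⟫_ℂ).re)
        ∧ (∃ j, 1 ≤ j ∧ (⟪xStart u₀ u₁ - y, y⟫_ℂ).re ^ 4 < ‖⟪xStart u₀ u₁ - y, (T ^ j) y⟫_ℂ‖)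
        ∧ IsMinimal (V T hT y) (xStart u₀ u₁) ‖xStart u₀ u₁ - y‖ c
        ∧ 1 - Lemma2.gammaEps T hT u₀ (⟪xStart u₀ u₁ - y, y⟫_ℂ).re ≤ ‖c 0‖ ^ 2
        ∧ ‖c 0‖ ^ 2 ≤ 1 - (98 / 100 * 10 ^ 20 * (⟪xStart u₀ u₁ - y, y⟫_ℂ).re ^ 11) ^ 2
        ∧ (98 / 100 * 10 ^ 20 * (⟪xStart u₀ u₁ - y, y⟫_ℂ).re ^ 11) ^ 2 ≤ ‖L c‖ ^ 2
        ∧ ‖L c‖ ^ 2 ≤ Lemma2.gammaEps T hT u₀ (⟪xStart u₀ u₁ - y, y⟫_ℂ).re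
        ∧ (1 - Lemma2.gammaEps T hT u₀ (⟪xStart u₀ u₁ - y, y⟫_ℂ).re) * ‖c‖ ^ 2 ≤ ‖c 0‖ ^ 2 := by
  have hT10 : ‖T‖ ≤ 1 / 10 := hT20.trans (by norm_num)
  have ht1' : t ≤ 1 / 100 := ht1.trans (by norm_num)
  obtain ⟨ε, a, h1, h2, ha, hn, him, hθ0, hθ, h9, hV1, hcone⟩ :=
    partA_entry_data T hT hT10 u₀ u₁ hu₀ hu₁ h01 ht0 ht1' hη
  have hx1 : ‖xStart u₀ u₁‖ = 1 := norm_xStart u₀ u₁ hu₀ hu₁ h01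
  have hwin : 0.3 ≤ ‖xStart u₀ u₁ - V T hT (yStart u₀) a‖ ∧ ‖xStart u₀ u₁ - V T hT (yStart u₀) a‖ ≤ 0.7 := by
    rw [hn]; constructor <;> linarith
  have hθ4 : (⟪xStart u₀ u₁ - V T hT (yStart u₀) a, V T hT (yStart u₀) a⟫_ℂ).re ≤ 1 / 10 ^ 4 := hθ.trans ht1
  rcases CaseII.partA_handoff T hT hT20 (xStart u₀ u₁) (V T hT (yStart u₀) a) u₀ hx1 hwin him hθ0 hθ4 h9
      hu₀.le hcone with
    hnis | ⟨y, c, hpos, hreal, hup, hlow, h07, -, hAdm, h9', hI, hmin, h33a, h33b, h33c, h33d, h33e⟩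
  · exact Or.inl hnis
  · right
    refine ⟨y, c, hpos, hreal, ?_, ?_, h07, hAdm, h9', hI, hmin, h33a, h33b, h33c, h33d, h33e⟩
    · exact hup.trans (by nlinarith)
    · linarith

/-! ### The sharpened choice of `u₁` exists under the standing hypotheses of p.1 -/

/-- **The p.7 choice of `u₁` exists, in the sharpened form Lemma 1 needs.**  If `T` has dense range and
`R(T) ≠ H` (standing hypotheses, v2 p.1), then for every unit vector `u₀` and every `η > 0` there is a unit vector
`u₁ ⟂ u₀` with `‖T*u₁‖ ≤ η`.  (Proof: otherwise `T*` is bounded below on `u₀^⊥`, hence — `T*` being injective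
by density of `R(T)` — bounded below on `H`; then `TT*` is bounded below and self-adjoint, so onto, so `T` is
onto.)  Dense range is load-bearing: for the forward shift `S` and `u₀ = e₀`, `‖S*u₁‖ = 1` for every unit
`u₁ ⟂ e₀`.  The manuscript asks only `‖T*u₁‖ < (εθ)₀`; Lemma 1 needs `η = 1.25·10⁻⁶(εθ)₀`
(`lemma1_printed_of_adjoint_le`). [cite: Enflo2023, v2 p.1 (standing hypotheses), p.7 (choice of u₁)] -/
theorem exists_unit_orthogonal_adjoint_le (T : H →L[ℂ] H) (hdense : DenseRange T)
    (hsurj : ¬ Function.Surjective T) (u₀ : H) (hu₀ : ‖u₀‖ = 1) {η : ℝ} (hη : 0 < η) :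
    ∃ u₁ : H, ‖u₁‖ = 1 ∧ ⟪u₀, u₁⟫_ℂ = 0 ∧ ‖adjoint T u₁‖ ≤ η := by
  classical
  by_contra hne
  push Not at hne
  -- (i) `T*` is bounded below by `η` on `u₀^⊥`
  have hK : ∀ v : H, ⟪u₀, v⟫_ℂ = 0 → η * ‖v‖ ≤ ‖adjoint T v‖ := by
    intro v hv
    by_cases hv0 : v = 0
    · simp [hv0]
    have hnv : 0 < ‖v‖ := norm_pos_iff.2 hv0
    have hunit : ‖((‖v‖⁻¹ : ℝ) : ℂ) • v‖ = 1 := by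
      rw [norm_smul, Complex.norm_real, Real.norm_of_nonneg (inv_nonneg.2 hnv.le), inv_mul_cancel₀ hnv.ne']
    have horth : ⟪u₀, ((‖v‖⁻¹ : ℝ) : ℂ) • v⟫_ℂ = 0 := by rw [inner_smul_right, hv, mul_zero]
    have h := hne _ hunit horth
    rw [map_smul, norm_smul, Complex.norm_real, Real.norm_of_nonneg (inv_nonneg.2 hnv.le)] at h
    have h2 : ‖v‖⁻¹ * ‖adjoint T v‖ * ‖v‖ = ‖adjoint T v‖ := by field_simp
    have h3 := mul_lt_mul_of_pos_right h hnv
    rw [h2] at h3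
    exact h3.le
  -- (ii) `T*` is injective, by density of `R(T)`
  have hAker : LinearMap.ker (adjoint T : H →ₗ[ℂ] H) = ⊥ := by
    have hd : Dense ((LinearMap.range (T : H →ₗ[ℂ] H) : Submodule ℂ H) : Set H) := by
      rw [LinearMap.coe_range]; exact hdense
    have h1 : (LinearMap.range (T : H →ₗ[ℂ] H))ᗮ = ⊥ := by
      rw [← Submodule.topologicalClosure_eq_top_iff]
      exact Submodule.dense_iff_topologicalClosure_eq_top.1 hd
    rw [← orthogonal_range T]; exact h1
  -- (iii) the closed subspace `T*(u₀^⊥)`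
  set K : Submodule ℂ H := (ℂ ∙ u₀)ᗮ with hKdef
  have hKmem : ∀ v : H, v ∈ K ↔ ⟪u₀, v⟫_ℂ = 0 := fun v => Submodule.mem_orthogonal_singleton_iff_inner_right
  haveI : CompleteSpace K := (Submodule.isClosed_orthogonal _).completeSpace_coe
  set AK : K →L[ℂ] H := (adjoint T).comp K.subtypeL with hAKdef
  have hAKapply : ∀ v : K, AK v = adjoint T (v : H) := fun v => rfl
  have hAK_anti : AntilipschitzWith (Real.toNNReal η⁻¹) AK := by
    refine ContinuousLinearMap.antilipschitz_of_bound AK fun v => ?_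
    rw [Real.coe_toNNReal _ (inv_nonneg.2 hη.le), hAKapply, le_inv_mul_iff₀ hη]
    exact hK v ((hKmem v).1 v.2)
  have hR₁closed : IsClosed (Set.range AK) := hAK_anti.isClosed_range AK.uniformContinuous
  -- (iv) `T*u₀ ∉ T*(u₀^⊥)` (else `T*` kills `u₀ − k ≠ 0`)
  have hnotin : adjoint T u₀ ∉ Set.range AK := by
    rintro ⟨k, hk⟩
    rw [hAKapply] at hk
    have h1 : (k : H) - u₀ ∈ LinearMap.ker (adjoint T : H →ₗ[ℂ] H) := by
      rw [LinearMap.mem_ker, ContinuousLinearMap.coe_coe, map_sub, hk, sub_self]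
    rw [hAker, Submodule.mem_bot, sub_eq_zero] at h1
    have h2 : ⟪u₀, u₀⟫_ℂ = 0 := by
      have := (hKmem k).1 k.2
      rwa [h1] at this
    rw [inner_self_eq_zero] at h2
    rw [h2, norm_zero] at hu₀
    exact zero_ne_one hu₀
  -- (v) its distance `d > 0` to that closed subspace, and `|α|·d ≤ ‖α T*u₀ + r‖` for `r ∈ T*(u₀^⊥)`
  obtain ⟨d, hd0, hd⟩ : ∃ d : ℝ, 0 < d ∧ ∀ r ∈ Set.range AK, d ≤ dist (adjoint T u₀) r :=
    ⟨Metric.infDist (adjoint T u₀) (Set.range AK),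
      (hR₁closed.notMem_iff_infDist_pos ⟨0, ⟨0, map_zero _⟩⟩).1 hnotin,
      fun r hr => Metric.infDist_le_dist_of_mem hr⟩
  have hcomb : ∀ (α : ℂ) (r : H), r ∈ Set.range AK → ‖α‖ * d ≤ ‖α • adjoint T u₀ + r‖ := by
    intro α r hr
    by_cases hα : α = 0
    · simp [hα]
    have hr' : -(α⁻¹ • r) ∈ Set.range AK := by
      obtain ⟨k, hk⟩ := hr
      exact ⟨-(α⁻¹ • k), by rw [map_neg, map_smul, hk]⟩
    have h1 := hd _ hr'
    rw [dist_eq_norm, sub_neg_eq_add] at h1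
    have h2 : α • adjoint T u₀ + r = α • (adjoint T u₀ + α⁻¹ • r) := by
      rw [smul_add, smul_inv_smul₀ hα]
    rw [h2, norm_smul]
    exact mul_le_mul_of_nonneg_left h1 (norm_nonneg α)
  -- (vi) so `T*` is bounded below on all of `H`: `‖x‖ ≤ B‖T*x‖`
  set M : ℝ := ‖adjoint T u₀‖ with hMdef
  set B : ℝ := 1 / d + (1 + M / d) / η with hBdef
  have hB0 : 0 < B := by positivity
  have hglob : ∀ x : H, ‖x‖ ≤ B * ‖adjoint T x‖ := by
    intro x
    obtain ⟨α, hα⟩ : ∃ α : ℂ, α = ⟪u₀, x⟫_ℂ := ⟨_, rfl⟩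
    obtain ⟨k, hkx⟩ : ∃ k : H, k = x - α • u₀ := ⟨_, rfl⟩
    have h00 : ⟪u₀, u₀⟫_ℂ = 1 := by rw [inner_self_eq_norm_sq_to_K, hu₀]; norm_num
    have hk : ⟪u₀, k⟫_ℂ = 0 := by
      rw [hkx, inner_sub_right, inner_smul_right, h00, ← hα, mul_one, sub_self]
    have hkK : adjoint T k ∈ Set.range AK := ⟨⟨k, (hKmem k).2 hk⟩, rfl⟩
    have hx : x = α • u₀ + k := by rw [hkx]; abel
    have hAx : adjoint T x = α • adjoint T u₀ + adjoint T k := by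
      conv_lhs => rw [hx]
      rw [map_add, map_smul]
    have h1 : ‖α‖ * d ≤ ‖adjoint T x‖ := by rw [hAx]; exact hcomb α _ hkK
    have h2 : η * ‖k‖ ≤ ‖adjoint T k‖ := hK k hk
    have h3 : ‖adjoint T k‖ ≤ ‖adjoint T x‖ + ‖α‖ * M := by
      have : adjoint T k = adjoint T x - α • adjoint T u₀ := by rw [hAx]; abel
      rw [this]
      calc ‖adjoint T x - α • adjoint T u₀‖ ≤ ‖adjoint T x‖ + ‖α • adjoint T u₀‖ := norm_sub_le _ _
        _ = ‖adjoint T x‖ + ‖α‖ * M := by rw [norm_smul]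
    have h4 : ‖x‖ ≤ ‖α‖ + ‖k‖ := by
      conv_lhs => rw [hx]
      calc ‖α • u₀ + k‖ ≤ ‖α • u₀‖ + ‖k‖ := norm_add_le _ _
        _ = ‖α‖ + ‖k‖ := by rw [norm_smul, hu₀, mul_one]
    have hα' : ‖α‖ ≤ ‖adjoint T x‖ / d := by rw [le_div_iff₀ hd0]; exact h1
    have hk' : ‖k‖ ≤ (‖adjoint T x‖ + ‖adjoint T x‖ / d * M) / η := by
      rw [le_div_iff₀ hη]
      have : ‖α‖ * M ≤ ‖adjoint T x‖ / d * M := mul_le_mul_of_nonneg_right hα' (norm_nonneg _)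
      linarith
    calc ‖x‖ ≤ ‖α‖ + ‖k‖ := h4
      _ ≤ ‖adjoint T x‖ / d + (‖adjoint T x‖ + ‖adjoint T x‖ / d * M) / η := add_le_add hα' hk'
      _ = B * ‖adjoint T x‖ := by rw [hBdef]; field_simp
  -- (vii) hence `TT*` is bounded below (`‖x‖ ≤ B²‖TT*x‖`), injective, self-adjoint, with closed dense range
  have hG : ∀ x : H, ‖x‖ ≤ B ^ 2 * ‖(T.comp (adjoint T)) x‖ := by
    intro x
    by_cases hx0 : x = 0
    · simp [hx0]
    have hnx : 0 < ‖x‖ := norm_pos_iff.2 hx0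
    have h2 : (⟪(T.comp (adjoint T)) x, x⟫_ℂ).re = ‖adjoint T x‖ ^ 2 := by
      rw [ContinuousLinearMap.comp_apply, ← adjoint_inner_right, inner_self_eq_norm_sq_to_K]; norm_cast
    have h1 : ‖adjoint T x‖ ^ 2 ≤ ‖(T.comp (adjoint T)) x‖ * ‖x‖ := by
      calc ‖adjoint T x‖ ^ 2 = (⟪(T.comp (adjoint T)) x, x⟫_ℂ).re := h2.symm
        _ ≤ ‖⟪(T.comp (adjoint T)) x, x⟫_ℂ‖ := Complex.re_le_norm _
        _ ≤ ‖(T.comp (adjoint T)) x‖ * ‖x‖ := norm_inner_le_norm _ _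
    have h3 : ‖x‖ ≤ B * ‖adjoint T x‖ := hglob x
    have h4 : ‖x‖ * ‖x‖ ≤ B ^ 2 * ‖(T.comp (adjoint T)) x‖ * ‖x‖ := by
      calc ‖x‖ * ‖x‖ = ‖x‖ ^ 2 := by ring
        _ ≤ (B * ‖adjoint T x‖) ^ 2 := pow_le_pow_left₀ (norm_nonneg _) h3 2
        _ = B ^ 2 * ‖adjoint T x‖ ^ 2 := by ring
        _ ≤ B ^ 2 * (‖(T.comp (adjoint T)) x‖ * ‖x‖) := mul_le_mul_of_nonneg_left h1 (sq_nonneg B)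
        _ = B ^ 2 * ‖(T.comp (adjoint T)) x‖ * ‖x‖ := by ring
    exact le_of_mul_le_mul_right h4 hnx
  have hGanti : AntilipschitzWith (Real.toNNReal (B ^ 2)) (T.comp (adjoint T)) :=
    ContinuousLinearMap.antilipschitz_of_bound _ fun x => by
      rw [Real.coe_toNNReal _ (sq_nonneg B)]; exact hG x
  have hGclosed : IsClosed (Set.range (T.comp (adjoint T))) :=
    hGanti.isClosed_range (ContinuousLinearMap.uniformContinuous _)
  have hGinj : Function.Injective (T.comp (adjoint T)) := hGanti.injective
  have hGsa : adjoint (T.comp (adjoint T)) = T.comp (adjoint T) := by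
    rw [adjoint_comp, adjoint_adjoint]
  have hGrange : LinearMap.range ((T.comp (adjoint T) : H →L[ℂ] H) : H →ₗ[ℂ] H) = ⊤ := by
    have hcl : (LinearMap.range ((T.comp (adjoint T) : H →L[ℂ] H) : H →ₗ[ℂ] H)).topologicalClosure = ⊤ := by
      rw [Submodule.topologicalClosure_eq_top_iff, orthogonal_range, hGsa]
      exact LinearMap.ker_eq_bot.2 hGinj
    have hclosed' : IsClosed ((LinearMap.range ((T.comp (adjoint T) : H →L[ℂ] H) : H →ₗ[ℂ] H) :
        Submodule ℂ H) : Set H) := by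
      rw [LinearMap.coe_range]; exact hGclosed
    rw [← hclosed'.submodule_topologicalClosure_eq]; exact hcl
  -- (viii) so `T` is onto — contradiction
  apply hsurj
  intro z
  obtain ⟨x, hx⟩ := LinearMap.range_eq_top.1 hGrange z
  exact ⟨adjoint T x, by simpa using hx⟩

/-- **Part A from the standing hypotheses of p.1** (`‖T‖ ≤ 10⁻²⁰` after scaling, `R(T)` dense and `≠ H`; a unit
vector `u₀`): for every target `0 < t ≤ 10⁻⁴` there IS a unit `u₁ ⟂ u₀` with `‖T*u₁‖ ≤ t/4`, and then
`partA_from_start` applies.  (With the printed `t = ½·10⁻⁵(εθ)₀` this is the p.7→p.15 chain of the manuscript,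
the choice of `u₁` sharpened as Lemma 1 requires.) [cite: Enflo2023, v2 p.1, pp.7–15] -/
theorem partA_from_standing (T : H →L[ℂ] H) (hT : ‖T‖ < 1) (hT20 : ‖T‖ ≤ 1 / 10 ^ 20)
    (hdense : DenseRange T) (hsurj : ¬ Function.Surjective T) (u₀ : H) (hu₀ : ‖u₀‖ = 1)
    {t : ℝ} (ht0 : 0 < t) (ht1 : t ≤ 1 / 10 ^ 4) :
    ∃ u₁ : H, ‖u₁‖ = 1 ∧ ⟪u₀, u₁⟫_ℂ = 0 ∧ ‖adjoint T u₁‖ ≤ t / 4 ∧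
    (HasNontrivialClosedInvariantSubspace T ∨
      ∃ (y : H) (c : ℓ2),
        0 < (⟪xStart u₀ u₁ - y, y⟫_ℂ).re
        ∧ (⟪xStart u₀ u₁ - y, y⟫_ℂ).im = 0
        ∧ (⟪xStart u₀ u₁ - y, y⟫_ℂ).re ≤ 1.12 * t
        ∧ 0.3 - 2.2 * t ≤ ‖xStart u₀ u₁ - y‖
        ∧ ‖xStart u₀ u₁ - y‖ ≤ 0.7
        ∧ y ∈ Lemma2.Adm u₀
        ∧ (∀ m : ℕ, ‖⟪xStart u₀ u₁ - y, (T ^ m) y⟫_ℂ‖ ≤ (⟪xStart u₀ u₁ - y, y⟫_ℂ).re)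
        ∧ (∃ j, 1 ≤ j ∧ (⟪xStart u₀ u₁ - y, y⟫_ℂ).re ^ 4 < ‖⟪xStart u₀ u₁ - y, (T ^ j) y⟫_ℂ‖)
        ∧ IsMinimal (V T hT y) (xStart u₀ u₁) ‖xStart u₀ u₁ - y‖ c
        ∧ 1 - Lemma2.gammaEps T hT u₀ (⟪xStart u₀ u₁ - y, y⟫_ℂ).re ≤ ‖c 0‖ ^ 2
        ∧ ‖c 0‖ ^ 2 ≤ 1 - (98 / 100 * 10 ^ 20 * (⟪xStart u₀ u₁ - y, y⟫_ℂ).re ^ 11) ^ 2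
        ∧ (98 / 100 * 10 ^ 20 * (⟪xStart u₀ u₁ - y, y⟫_ℂ).re ^ 11) ^ 2 ≤ ‖L c‖ ^ 2
        ∧ ‖L c‖ ^ 2 ≤ Lemma2.gammaEps T hT u₀ (⟪xStart u₀ u₁ - y, y⟫_ℂ).re
        ∧ (1 - Lemma2.gammaEps T hT u₀ (⟪xStart u₀ u₁ - y, y⟫_ℂ).re) * ‖c‖ ^ 2 ≤ ‖c 0‖ ^ 2) := by
  obtain ⟨u₁, hu₁, h01, hη⟩ :=
    exists_unit_orthogonal_adjoint_le T hdense hsurj u₀ hu₀ (by positivity : 0 < t / 4)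
  exact ⟨u₁, hu₁, h01, hη, partA_from_start T hT hT20 u₀ u₁ hu₀ hu₁ h01 ht0 ht1 hη⟩

end Lemma1

end Literature.Analysis.OperatorTheory.Enflo2023
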